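import Summits.CriticalPhenomena.PercolationContinuityZ3.Theorems.PercNearOneGluingNoHeavyQuantConvAtoms
import Summits.CriticalPhenomena.PercolationContinuityZ3.Theorems.PercNearOneGluingNoHeavyQuantGatedConvReduction
import HarnessLib

/-!
# QUANT lane R8 — CLOSURE CHECK OF THE LAW-LEVEL ARCHITECTURE: `Quant.FarTreeRow` (and `Quant.TreeDEC`, `LawDec.TreeBuiltDEC`,
# `LawDec.SDECConvClosed`, `LawDec.ConvClosedT`) follow IN THE KERNEL from exactly three named finite-type statements

builds on p205010 (kernel theorem, internal audit signed; external expert review pending)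

Support file (`--supports stmt-CriticalPhenomena-4575`), QUANT lane LEAD seat prim-quant-lead (gen 24), rung R8 of
`run/shared/lean/prim/quant/LADDER.md` (README V279, PLANNER-BRIEF §18).  Theorems only (compositions of landed theorems), standard axioms, no sorries.

THE THREE STATEMENTS (all typed, all `@[conjecture]`, each with an exact census and an owner — README V276/V278/V279):
(I)   `LawDec.WindowAtomDecomposition` (census-2 g56, `…QuantConvAtoms`): every probability law that is DEC on a window of layers is a finite mixture of
      window-DEC laws with ≤ 2 lows and ≤ 2 absorbers (DD atlas: 11 060 278 extreme rays, none with ≥ 5 atoms);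
(II)  `LawDec.ConvClosedTResidue` (`…QuantConvAtoms`; census-1): convolution closure for pairs of SMALL laws neither of which has a straddler-free datum
      (2-low atom ⊗ 2-low atom; 249 078 581 atomic pairs / 0);
(III) `LawDec.GatedConvEmptyFree` (typer g25, `…QuantGatedConvReduction`): the empty-free gated convolution / root-gluing (E; ≈ 640 000 exact instances / 0,
      five engines).
THE CHAIN (all kernel): (I) ∧ (II) ⟹ `ConvClosedT` (`convClosedT_of_atoms_residue`, census-2 g56, on census-1 g20's one-sided theorem `lconv_decAtT_of_window_bdecAtT'`
and the slice theorems `sliceClosedWindowT_holds`); `ConvClosedT` ∧ (III) ⟹ `SDECConvClosed` (`sdecConvClosed_of_convClosedT_of_gatedConvEmptyFree`, typer g25's split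
identity); `SDECConvClosed` ⟹ `TreeBuiltDEC` (census-2 g53) ⟹ `TreeBuiltFAR` ⟹ `Quant.FarTreeRow` (lead g20's bridge); `SDECConvClosed` ⟹ `Quant.TreeDEC` (lead g20).

* `Quant.farTreeRow_of_three`, `Quant.treeDEC_of_three`, `LawDec.treeBuiltDEC_of_three`, `LawDec.sdecConvClosed_of_three`, `LawDec.convClosedT_of_two`.

HONEST STATUS: (I), (II), (III) are OPEN; nothing here proves them; the RATE registers are untouched.  This file exists so that "the tree row rests on exactly
these three statements" is a kernel-checked sentence and so that the moment the last of them lands `Quant.farTreeRow_of_three` closes R8 on trees by `exact`.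
[this work]; architecture prim-quant-census-2 g49/g53/g56, census-1 g20, typer g22–g25, leads g20–g24 (this lane).  The gluing rows served
[cite: KozmaNitzan2024, Conjecture 3 (p. 15)]; product measure [cite: Grimmett1999, §1.3 p. 10].
-/

namespace Summit.CriticalPhenomena.PercolationContinuityZ3.Theorems

namespace Quant

namespace LawDec

/-- **(I) ∧ (II) ⟹ `ConvClosedT`** (census-2 g56's `convClosedT_of_atoms_residue`, re-exported under the lane's naming). [this work] -/
theorem convClosedT_of_two (hI : WindowAtomDecomposition) (hII : ConvClosedTResidue) : ConvClosedT :=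
  convClosedT_of_atoms_residue hI hII

/-- **(I) ∧ (II) ∧ (III) ⟹ `SDECConvClosed`**. [this work] -/
theorem sdecConvClosed_of_three (hI : WindowAtomDecomposition) (hII : ConvClosedTResidue) (hIII : GatedConvEmptyFree) : SDECConvClosed :=
  sdecConvClosed_of_convClosedT_of_gatedConvEmptyFree (convClosedT_of_two hI hII) hIII

/-- **(I) ∧ (II) ∧ (III) ⟹ `TreeBuiltDEC`** (every tree-built count law is DEC at every layer). [this work] -/
theorem treeBuiltDEC_of_three (hI : WindowAtomDecomposition) (hII : ConvClosedTResidue) (hIII : GatedConvEmptyFree) : TreeBuiltDEC :=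
  treeBuiltDEC_of_sdecConvClosed (sdecConvClosed_of_three hI hII hIII)

end LawDec

/-- **(I) ∧ (II) ∧ (III) ⟹ `Quant.TreeDEC`** (the typed finite-layer T-DEC conjecture for every rooted forest). [this work] -/
theorem treeDEC_of_three (hI : LawDec.WindowAtomDecomposition) (hII : LawDec.ConvClosedTResidue) (hIII : LawDec.GatedConvEmptyFree) : TreeDEC :=
  treeDEC_of_sdecConvClosed (LawDec.sdecConvClosed_of_three hI hII hIII)

/-- **(I) ∧ (II) ∧ (III) ⟹ `Quant.FarTreeRow`** — FAR on trees (gate coordinates) from the three named finite-type law-level statements.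
CONDITIONAL result: all three are `@[conjecture]`. [this work] -/
theorem farTreeRow_of_three (hI : LawDec.WindowAtomDecomposition) (hII : LawDec.ConvClosedTResidue) (hIII : LawDec.GatedConvEmptyFree) :
    FarTreeRow :=
  farTreeRow_of_sdecConvClosed (LawDec.sdecConvClosed_of_three hI hII hIII)

end Quant

end Summit.CriticalPhenomena.PercolationContinuityZ3.Theorems
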